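/-
Copyright (c) 2026. All rights reserved.
Released under Apache 2.0 license as described in the file LICENSE.
Authors: abc-iut cell, seat abc-iut-L4-t15 (gen 6).
-/
import Mathlib.GroupTheory.Commutator.Basic
import Mathlib.GroupTheory.QuotientGroup.Defs
import Mathlib.Algebra.BigOperators.Fin
import Mathlib.Tactic.Group
import Mathlib.Algebra.Group.Submonoid.BigOperators
import Mathlib.Data.SetLike.Fintype
import Mathlib.Data.Fintype.Pigeonhole

/-!
# The lower `G`-central series of a normal subgroup and the Nikolov–Segal "hypocentral" lemma

For a normal subgroup `H` of a group `G` write `H₀ = H`, `H_{n+1} = ⁅H_n, G⁆` (inline: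
`(fun K => ⁅K, ⊤⁆)^[n] H`).  This file proves:

* `commutator_commutator_le_of_rotate` — the three-subgroup lemma MODULO a normal subgroup
  (Mathlib has the `= ⊥` form `Subgroup.commutator_commutator_eq_bot_of_rotate`);
* `commutator_iterate_commutator_top_le` — `⁅H_n, ⁅G, G⁆⁆ ≤ H_{n+2}`;
* `exists_prod_commutator_of_mem_commutator` — a central layer `⁅A,G⁆/C` (`⁅⁅A,G⁆,G⁆ ≤ C`) is exhausted,
  modulo `C`, by ordered products `∏_j ⁅w j, g j⁆` (`w j ∈ A`) over any tuple `g` generating `G`;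
* **`exists_prod_commutator_inv_mul_mem_iterate`** — Nikolov–Segal, Ann. of Math. 165 (2007), Lemma 2.4
  (case `G = ⟨g_1, …, g_d⟩`): for every `n` and every `h ∈ ⁅H, G⁆` there are `v j ∈ H` with
  `(∏_j ⁅v j, g j⁆)⁻¹ * h ∈ H_{n+1}` — i.e. `⁅H,G⁆ = ⁅H,g_1⁆ ⋯ ⁅H,g_d⁆ · H_{n+1}` for all `n`; the number
  of commutator factors does not grow with `n` because the corrections are central modulo the next term;
* `exists_iterate_commutator_eq_succ` — in a finite group the series stabilises: some `K₀ = H_N` satisfies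
  `⁅K₀, G⁆ = K₀`.

Pure group theory over Mathlib (convention `⁅a,b⁆ = aba⁻¹b⁻¹`); no definitions, no instances.  Used by
`Literature/GroupTheory/BoundedCommutatorWidthPByMetacyclic.lean` (cell abc-iut, GAP-LEDGER G-L3d2g2-1).
-/

namespace Literature.GroupTheory

open scoped commutatorElement

variable {G : Type*} [Group G]

/-! ### Three subgroups lemma modulo a normal subgroup -/

/-- **Three subgroups lemma, relative form.** If `N ⊴ G` and `⁅⁅H₂,H₃⁆,H₁⁆ ≤ N`, `⁅⁅H₃,H₁⁆,H₂⁆ ≤ N`,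
then `⁅⁅H₁,H₂⁆,H₃⁆ ≤ N` (apply Mathlib's `⊥`-version in `G ⧸ N`). Standard (P. Hall).
[cite: NikolovSegal2007, Lemma 4.2] -/
theorem commutator_commutator_le_of_rotate (N : Subgroup G) [N.Normal] {H₁ H₂ H₃ : Subgroup G}
    (h1 : ⁅⁅H₂, H₃⁆, H₁⁆ ≤ N) (h2 : ⁅⁅H₃, H₁⁆, H₂⁆ ≤ N) : ⁅⁅H₁, H₂⁆, H₃⁆ ≤ N := by
  have key : ∀ {K : Subgroup G}, K ≤ N ↔ K.map (QuotientGroup.mk' N) = ⊥ := by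
    intro K
    rw [Subgroup.map_eq_bot_iff, QuotientGroup.ker_mk']
  rw [key, Subgroup.map_commutator, Subgroup.map_commutator] at h1 h2 ⊢
  exact Subgroup.commutator_commutator_eq_bot_of_rotate h1 h2

/-! ### The lower `G`-central series of a normal subgroup -/

/-- The terms `H_n = (K ↦ ⁅K,G⁆)^[n] H` of the lower `G`-central series of a normal subgroup are normal.
[cite: NikolovSegal2007, §2] -/
theorem normal_iterate_commutator_top (H : Subgroup G) [hH : H.Normal] (n : ℕ) :
    ((fun K : Subgroup G => ⁅K, (⊤ : Subgroup G)⁆)^[n] H).Normal := by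
  induction n with
  | zero => simpa using hH
  | succ n ih =>
    rw [Function.iterate_succ_apply']
    haveI := ih
    infer_instance

/-- The lower `G`-central series is decreasing: `H_{n+1} ≤ H_n`. [cite: NikolovSegal2007, §2] -/
theorem iterate_commutator_top_succ_le (H : Subgroup G) [H.Normal] (n : ℕ) :
    (fun K : Subgroup G => ⁅K, (⊤ : Subgroup G)⁆)^[n + 1] H ≤
      (fun K : Subgroup G => ⁅K, (⊤ : Subgroup G)⁆)^[n] H := by
  rw [Function.iterate_succ_apply']
  haveI := normal_iterate_commutator_top H n
  exact Subgroup.commutator_le_left _ _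

/-- The lower `G`-central series is antitone in the index. [cite: NikolovSegal2007, §2] -/
theorem iterate_commutator_top_le_of_le (H : Subgroup G) [H.Normal] {m n : ℕ} (hmn : m ≤ n) :
    (fun K : Subgroup G => ⁅K, (⊤ : Subgroup G)⁆)^[n] H ≤
      (fun K : Subgroup G => ⁅K, (⊤ : Subgroup G)⁆)^[m] H := by
  induction hmn with
  | refl => exact le_rfl
  | step _ ih => exact (iterate_commutator_top_succ_le H _).trans ih

/-- All terms lie in `H`. [cite: NikolovSegal2007, §2] -/
theorem iterate_commutator_top_le (H : Subgroup G) [H.Normal] (n : ℕ) :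
    (fun K : Subgroup G => ⁅K, (⊤ : Subgroup G)⁆)^[n] H ≤ H := by
  simpa using iterate_commutator_top_le_of_le H (Nat.zero_le n)

/-- **`⁅H_n, G'⁆ ≤ H_{n+2}`** for the lower `G`-central series of a normal subgroup `H`
(three subgroups lemma). [cite: NikolovSegal2007, Lemma 2.4] -/
theorem commutator_iterate_commutator_top_le (H : Subgroup G) [H.Normal] (n : ℕ) :
    ⁅(fun K : Subgroup G => ⁅K, (⊤ : Subgroup G)⁆)^[n] H, ⁅(⊤ : Subgroup G), (⊤ : Subgroup G)⁆⁆ ≤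
      (fun K : Subgroup G => ⁅K, (⊤ : Subgroup G)⁆)^[n + 2] H := by
  set T : ℕ → Subgroup G := fun m => (fun K : Subgroup G => ⁅K, (⊤ : Subgroup G)⁆)^[m] H with hT
  haveI : (T (n + 2)).Normal := normal_iterate_commutator_top H (n + 2)
  have h12 : T (n + 2) = ⁅⁅T n, (⊤ : Subgroup G)⁆, (⊤ : Subgroup G)⁆ := by
    simp only [hT, Function.iterate_succ_apply']
  rw [Subgroup.commutator_comm]
  apply commutator_commutator_le_of_rotate (T (n + 2))
  · -- `⁅⁅⊤, T n⁆, ⊤⁆ ≤ T (n+2)`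
    rw [Subgroup.commutator_comm ⊤ (T n), h12]
  · -- `⁅⁅T n, ⊤⁆, ⊤⁆ ≤ T (n+2)`
    rw [h12]

/-! ### Ordered products with central factors -/

/-- If all `b j` are central, `∏_j (a j * b j) = (∏_j a j) * (∏_j b j)`. [folklore] -/
private theorem prod_ofFn_mul_of_mem_center {Q : Type*} [Group Q] {d : ℕ} (a b : Fin d → Q)
    (hb : ∀ j, b j ∈ Subgroup.center Q) :
    (List.ofFn fun j => a j * b j).prod = (List.ofFn a).prod * (List.ofFn b).prod := by
  induction d with
  | zero => simp
  | succ d ih =>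
    simp only [List.ofFn_succ, List.prod_cons]
    rw [ih (fun i => a i.succ) (fun i => b i.succ) (fun i => hb i.succ)]
    have hc : b 0 * (List.ofFn fun i : Fin d => a i.succ).prod =
        (List.ofFn fun i : Fin d => a i.succ).prod * b 0 :=
      (Subgroup.mem_center_iff.mp (hb 0) _).symm
    calc a 0 * b 0 * ((List.ofFn fun i : Fin d => a i.succ).prod * (List.ofFn fun i => b i.succ).prod)
        = a 0 * (b 0 * (List.ofFn fun i : Fin d => a i.succ).prod) *
            (List.ofFn fun i => b i.succ).prod := by simp only [mul_assoc]
      _ = a 0 * (List.ofFn fun i : Fin d => a i.succ).prod * (b 0 * (List.ofFn fun i => b i.succ).prod) := by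
          rw [hc]; simp only [mul_assoc]

/-- Images of a subgroup `B` are central in `G ⧸ C` when `⁅B, G⁆ ≤ C`. [folklore] -/
private theorem mk_mem_center_of_commutator_le {B C : Subgroup G} [C.Normal]
    (hBC : ⁅B, (⊤ : Subgroup G)⁆ ≤ C) {b : G} (hb : b ∈ B) :
    (QuotientGroup.mk' C b) ∈ Subgroup.center (G ⧸ C) := by
  rw [Subgroup.mem_center_iff]
  intro q
  obtain ⟨y, rfl⟩ := QuotientGroup.mk'_surjective C q
  rw [← map_mul, ← map_mul, QuotientGroup.mk'_apply, QuotientGroup.mk'_apply, eq_comm,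
    QuotientGroup.eq]
  have hmem : ⁅b, y⁆ ∈ C := hBC (Subgroup.commutator_mem_commutator hb (Subgroup.mem_top y))
  have : (b * y)⁻¹ * (y * b) = (b * y)⁻¹ * ⁅b, y⁆⁻¹ * (b * y) := by
    simp only [commutatorElement_def]; group
  rw [this]
  exact ‹C.Normal›.conj_mem' _ (C.inv_mem hmem) (b * y)

/-- An ordered product whose entries are `1` except at one slot equals that entry. [folklore] -/
private theorem prod_ofFn_update_one {M : Type*} [Monoid M] :
    ∀ {d : ℕ} (j : Fin d) (a : M), (List.ofFn (Function.update (fun _ : Fin d => (1 : M)) j a)).prod = a := by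
  intro d
  induction d with
  | zero => intro j; exact Fin.elim0 j
  | succ d ih =>
    intro j a
    rw [List.ofFn_succ, List.prod_cons]
    refine Fin.cases ?_ (fun j' => ?_) j
    · -- slot `0`
      rw [Function.update_self]
      have : (List.ofFn fun i : Fin d => Function.update (fun _ : Fin (d + 1) => (1 : M)) 0 a i.succ) =
          List.ofFn (fun _ : Fin d => (1 : M)) := by
        refine congrArg List.ofFn (funext fun i => ?_)
        rw [Function.update_of_ne (Fin.succ_ne_zero i)]
      rw [this]
      simp
    · -- slot `j'.succ`
      rw [Function.update_of_ne (Fin.succ_ne_zero j').symm, one_mul]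
      have : (fun i : Fin d => Function.update (fun _ : Fin (d + 1) => (1 : M)) j'.succ a i.succ) =
          Function.update (fun _ : Fin d => (1 : M)) j' a := by
        funext i
        by_cases h : i = j'
        · subst h; simp
        · rw [Function.update_of_ne h, Function.update_of_ne]
          exact fun h' => h (Fin.succ_inj.mp h')
      rw [this, ih]

/-! ### The central layer `H_{n+1}/H_{n+2}` is exhausted by ordered products over generators -/

/-- **Layer lemma.** Let `A ⊴ G`, `B = ⁅A, G⁆`, and `C ⊴ G` with `⁅B, G⁆ ≤ C` (so `B/C` is central in
`G/C`).  If `g : Fin d → G` generates `G`, then every `z ∈ B` is congruent modulo `C` to an ordered product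
`∏_j ⁅w j, g j⁆` with `w j ∈ A`: `z⁻¹ * ∏_j ⁅w j, g j⁆ ∈ C`.  (Bilinearity of the commutator pairing
`A × G → B/C`.) [cite: NikolovSegal2007, Lemma 2.4] -/
theorem exists_prod_commutator_of_mem_commutator {d : ℕ} (g : Fin d → G)
    (hgen : Subgroup.closure (Set.range g) = ⊤) (A C : Subgroup G) [A.Normal] [hC : C.Normal]
    (hBC : ⁅⁅A, (⊤ : Subgroup G)⁆, (⊤ : Subgroup G)⁆ ≤ C) {z : G} (hz : z ∈ ⁅A, (⊤ : Subgroup G)⁆) :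
    ∃ w : Fin d → G, (∀ j, w j ∈ A) ∧ z⁻¹ * (List.ofFn fun j => ⁅w j, g j⁆).prod ∈ C := by
  classical
  set B : Subgroup G := ⁅A, (⊤ : Subgroup G)⁆ with hB
  let mk := QuotientGroup.mk' C
  -- reformulate the target as an equality in `G ⧸ C`
  have goal_iff : ∀ (z : G) (w : Fin d → G),
      z⁻¹ * (List.ofFn fun j => ⁅w j, g j⁆).prod ∈ C ↔
        mk z = (List.ofFn fun j => mk ⁅w j, g j⁆).prod := by
    intro z w
    rw [← QuotientGroup.eq, QuotientGroup.mk'_apply]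
    change _ ↔ _ = (List.ofFn (mk ∘ fun j => ⁅w j, g j⁆)).prod
    rw [← List.map_ofFn, ← map_list_prod]
    rfl
  -- central images
  have hcen : ∀ {a : G}, a ∈ A → ∀ y : G, mk ⁅a, y⁆ ∈ Subgroup.center (G ⧸ C) := fun ha y =>
    mk_mem_center_of_commutator_le hBC (Subgroup.commutator_mem_commutator ha (Subgroup.mem_top y))
  -- `⁅A, B⁆ ≤ C`
  have hAB : ⁅A, B⁆ ≤ C := by
    rw [Subgroup.commutator_comm]
    exact (Subgroup.commutator_mono le_rfl le_top).trans hBC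
  -- multiplicativity: products of representable classes are representable (entries multiply)
  have hmul : ∀ w w' : Fin d → G, (∀ j, w j ∈ A) → (∀ j, w' j ∈ A) →
      (List.ofFn fun j => mk ⁅w j, g j⁆).prod * (List.ofFn fun j => mk ⁅w' j, g j⁆).prod =
        (List.ofFn fun j => mk ⁅w j * w' j, g j⁆).prod := by
    intro w w' hw hw'
    rw [← prod_ofFn_mul_of_mem_center _ _ (fun j => hcen (hw' j) (g j))]
    refine congrArg (fun f : Fin d → G ⧸ C => (List.ofFn f).prod) (funext fun j => ?_)
    -- `⁅w w', g⁆ = w ⁅w',g⁆ w⁻¹ ⁅w,g⁆ = ⁅w,⁅w',g⁆⁆ ⁅w',g⁆ ⁅w,g⁆ ≡ ⁅w,g⁆ ⁅w',g⁆`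
    rw [← map_mul, eq_comm, QuotientGroup.mk'_apply, QuotientGroup.mk'_apply, QuotientGroup.eq,
      commutatorElement_mul_left_eq_conj_mul]
    have h1 : w j * ⁅w' j, g j⁆ * (w j)⁻¹ = ⁅w j, ⁅w' j, g j⁆⁆ * ⁅w' j, g j⁆ := by
      simp only [commutatorElement_def]; group
    rw [h1]
    -- `(⁅w,⁅w',g⁆⁆ ⁅w',g⁆ ⁅w,g⁆)⁻¹ (⁅w,g⁆ ⁅w',g⁆)`: the `⁅w,⁅w',g⁆⁆ ∈ C` part and a commutator of centrals
    have hc1 : ⁅w j, ⁅w' j, g j⁆⁆ ∈ C :=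
      hAB (Subgroup.commutator_mem_commutator (hw j)
        (Subgroup.commutator_mem_commutator (hw' j) (Subgroup.mem_top _)))
    have hbB : ⁅w j, g j⁆⁻¹ ∈ B := B.inv_mem (Subgroup.commutator_mem_commutator (hw j) (Subgroup.mem_top _))
    have hc2 : ⁅⁅w j, g j⁆⁻¹, ⁅w' j, g j⁆⁻¹⁆ ∈ C :=
      hBC (Subgroup.commutator_mem_commutator hbB (Subgroup.mem_top _))
    have heq : (⁅w j, ⁅w' j, g j⁆⁆ * ⁅w' j, g j⁆ * ⁅w j, g j⁆)⁻¹ * (⁅w j, g j⁆ * ⁅w' j, g j⁆) =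
        ((⁅w' j, g j⁆ * ⁅w j, g j⁆)⁻¹ * ⁅w j, ⁅w' j, g j⁆⁆⁻¹ * (⁅w' j, g j⁆ * ⁅w j, g j⁆)) *
          ⁅⁅w j, g j⁆⁻¹, ⁅w' j, g j⁆⁻¹⁆ := by
      simp only [commutatorElement_def]; group
    rw [heq]
    exact C.mul_mem (hC.conj_mem' _ (C.inv_mem hc1) _) hc2
  -- `1 = ∏ mk ⁅1, g⁆`
  have hone : (List.ofFn fun j => mk ⁅(1 : G), g j⁆).prod = 1 := by simp
  -- inverses: a representation of `q` yields one of `q⁻¹` with inverted entries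
  have hinv : ∀ w : Fin d → G, (∀ j, w j ∈ A) →
      ((List.ofFn fun j => mk ⁅w j, g j⁆).prod)⁻¹ = (List.ofFn fun j => mk ⁅(w j)⁻¹, g j⁆).prod := by
    intro w hw
    apply inv_eq_of_mul_eq_one_right
    rw [hmul w (fun j => (w j)⁻¹) hw (fun j => A.inv_mem (hw j))]
    simp
  -- conjugation by `y` does not change the class of an element of `B`
  have hconjB : ∀ {c : G}, c ∈ B → ∀ y : G, mk (y * c * y⁻¹) = mk c := by
    intro c hc y
    have hcen' : mk c ∈ Subgroup.center (G ⧸ C) := mk_mem_center_of_commutator_le hBC hc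
    rw [map_mul, map_mul, map_inv, Subgroup.mem_center_iff.mp hcen' (mk y), mul_inv_cancel_right]
  -- the predicate
  let P : G → Prop := fun z => ∃ w : Fin d → G, (∀ j, w j ∈ A) ∧
    mk z = (List.ofFn fun j => mk ⁅w j, g j⁆).prod
  have P_one : P 1 := ⟨fun _ => 1, fun _ => A.one_mem, by rw [map_one, hone]⟩
  have P_mul : ∀ z z', P z → P z' → P (z * z') := by
    rintro z z' ⟨w, hw, hz⟩ ⟨w', hw', hz'⟩
    exact ⟨fun j => w j * w' j, fun j => A.mul_mem (hw j) (hw' j), by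
      rw [map_mul, hz, hz', hmul w w' hw hw']⟩
  have P_inv : ∀ z, P z → P z⁻¹ := by
    rintro z ⟨w, hw, hz⟩
    exact ⟨fun j => (w j)⁻¹, fun j => A.inv_mem (hw j), by rw [map_inv, hz, hinv w hw]⟩
  -- generators `⁅a, y⁆`, by induction over `y ∈ closure (range g)`
  have P_gen : ∀ a ∈ A, ∀ y : G, P ⁅a, y⁆ := by
    intro a ha y
    have hy : y ∈ Subgroup.closure (Set.range g) := by rw [hgen]; exact Subgroup.mem_top y
    induction hy using Subgroup.closure_induction with
    | mem x hx =>
      obtain ⟨j, rfl⟩ := hx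
      refine ⟨Function.update (fun _ => (1 : G)) j a, fun j' => ?_, ?_⟩
      · by_cases h : j' = j
        · subst h; simpa using ha
        · rw [Function.update_of_ne h]; exact A.one_mem
      · have : (fun j' => mk ⁅Function.update (fun _ => (1 : G)) j a j', g j'⁆) =
            Function.update (fun _ : Fin d => (1 : G ⧸ C)) j (mk ⁅a, g j⁆) := by
          funext j'
          by_cases h : j' = j
          · subst h; simp
          · rw [Function.update_of_ne h, Function.update_of_ne h]; simp
        rw [this, prod_ofFn_update_one]
    | one => simpa using P_one
    | mul x y _ _ hx hy =>
      obtain ⟨w, hw, hxw⟩ := hx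
      obtain ⟨w', hw', hyw⟩ := hy
      refine ⟨fun j => w j * w' j, fun j => A.mul_mem (hw j) (hw' j), ?_⟩
      have hxy : ⁅a, x * y⁆ = ⁅a, x⁆ * (x * ⁅a, y⁆ * x⁻¹) := by
        rw [commutatorElement_mul_right_eq_mul_conj]; group
      rw [hxy, map_mul, hconjB (Subgroup.commutator_mem_commutator ha (Subgroup.mem_top y)) x,
        hxw, hyw, hmul w w' hw hw']
    | inv x _ hx =>
      obtain ⟨w, hw, hxw⟩ := hx
      refine ⟨fun j => (w j)⁻¹, fun j => A.inv_mem (hw j), ?_⟩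
      rw [commutatorElement_inv_right, ← hinv w hw, ← hxw, ← commutatorElement_inv, ← map_inv]
      have := hconjB (B.inv_mem (Subgroup.commutator_mem_commutator ha (Subgroup.mem_top x))) x⁻¹
      simpa [mul_assoc] using this
  -- closure induction over `z ∈ B = closure {⁅a, y⁆}`
  have hzB : z ∈ Subgroup.closure {x | ∃ a ∈ A, ∃ y ∈ (⊤ : Subgroup G), ⁅a, y⁆ = x} := by
    rw [← Subgroup.commutator_def]; exact hz
  have key : ∀ x ∈ Subgroup.closure {x | ∃ a ∈ A, ∃ y ∈ (⊤ : Subgroup G), ⁅a, y⁆ = x}, P x := by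
    intro x hx
    induction hx using Subgroup.closure_induction with
    | mem x hx =>
      obtain ⟨a, ha, y, -, rfl⟩ := hx
      exact P_gen a ha y
    | one => exact P_one
    | mul x y _ _ hx hy => exact P_mul x y hx hy
    | inv x _ hx => exact P_inv x hx
  obtain ⟨w, hw, hzw⟩ := key z hzB
  exact ⟨w, hw, (goal_iff z w).mpr hzw⟩

/-! ### Nikolov–Segal Lemma 2.4: the top (hypocentral) stage -/

/-- **Nikolov–Segal, Lemma 2.4** (case `G = ⟨g_1,…,g_d⟩`).  Let `H ⊴ G` and let `g : Fin d → G` generate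
`G`.  Then for every `n` and every `h ∈ ⁅H, G⁆` there are entries `v j ∈ H` with
`(∏_j ⁅v j, g j⁆)⁻¹ * h ∈ H_{n+1}`, where `H_{n+1} = (K ↦ ⁅K,G⁆)^[n+1] H`; i.e.
`⁅H, G⁆ = ⁅H, g_1⁆ ⋯ ⁅H, g_d⁆ · ⁅H,_{n+1} G⁆` as a product of SETS, for every `n ≥ 0`.  The number of
commutators stays `d` because the successive corrections are central modulo the next term and merge into
the same slots. [cite: NikolovSegal2007, Lemma 2.4] -/
theorem exists_prod_commutator_inv_mul_mem_iterate {d : ℕ} (g : Fin d → G)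
    (hgen : Subgroup.closure (Set.range g) = ⊤) (H : Subgroup G) [hH : H.Normal] (n : ℕ)
    {h : G} (hh : h ∈ ⁅H, (⊤ : Subgroup G)⁆) :
    ∃ v : Fin d → G, (∀ j, v j ∈ H) ∧
      ((List.ofFn fun j => ⁅v j, g j⁆).prod)⁻¹ * h ∈
        (fun K : Subgroup G => ⁅K, (⊤ : Subgroup G)⁆)^[n + 1] H := by
  set T : ℕ → Subgroup G := fun m => (fun K : Subgroup G => ⁅K, (⊤ : Subgroup G)⁆)^[m] H with hT
  induction n with
  | zero =>
    refine ⟨fun _ => 1, fun _ => H.one_mem, ?_⟩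
    simpa [hT] using hh
  | succ n ih =>
    obtain ⟨v, hvH, hv⟩ := ih
    -- notation and instances
    haveI hTn : (T n).Normal := normal_iterate_commutator_top H n
    haveI hTn2 : (T (n + 2)).Normal := normal_iterate_commutator_top H (n + 2)
    have hT1 : T (n + 1) = ⁅T n, (⊤ : Subgroup G)⁆ := by
      simp only [hT, Function.iterate_succ_apply']
    have hT2 : T (n + 2) = ⁅⁅T n, (⊤ : Subgroup G)⁆, (⊤ : Subgroup G)⁆ := by
      simp only [hT, Function.iterate_succ_apply']
    set z : G := ((List.ofFn fun j => ⁅v j, g j⁆).prod)⁻¹ * h with hz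
    have hzB : z ∈ ⁅T n, (⊤ : Subgroup G)⁆ := by rw [← hT1]; exact hv
    -- represent the class of `z` modulo `T (n+2)` by an ordered product with entries in `T n`
    obtain ⟨w, hw, hzw⟩ := exists_prod_commutator_of_mem_commutator g hgen (T n) (T (n + 2))
      (by rw [hT2]) hzB
    refine ⟨fun j => w j * v j, fun j => H.mul_mem (iterate_commutator_top_le H n (hw j)) (hvH j), ?_⟩
    -- compute in `G ⧸ T (n+2)`
    change _ ∈ T (n + 1 + 1)
    rw [show n + 1 + 1 = n + 2 by ring, ← QuotientGroup.eq]
    let mk := QuotientGroup.mk' (T (n + 2))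
    change mk _ = mk h
    have hTn1_le : ⁅T (n + 1), (⊤ : Subgroup G)⁆ ≤ T (n + 2) := by rw [hT2, hT1]
    -- `⁅T n, ⁅H, G⁆⁆ ≤ T (n+2)` (three subgroups lemma)
    have h3 : ⁅T n, ⁅H, (⊤ : Subgroup G)⁆⁆ ≤ T (n + 2) :=
      (Subgroup.commutator_mono le_rfl (Subgroup.commutator_mono le_top le_rfl)).trans
        (commutator_iterate_commutator_top_le H n)
    -- each factor: `mk ⁅w v, g⁆ = mk ⁅v, g⁆ * mk ⁅w, g⁆`
    have hfac : ∀ j, mk ⁅w j * v j, g j⁆ = mk ⁅v j, g j⁆ * mk ⁅w j, g j⁆ := by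
      intro j
      rw [commutatorElement_mul_left_eq_conj_mul]
      have h1 : w j * ⁅v j, g j⁆ * (w j)⁻¹ * ⁅w j, g j⁆ =
          ⁅w j, ⁅v j, g j⁆⁆ * (⁅v j, g j⁆ * ⁅w j, g j⁆) := by
        simp only [commutatorElement_def]; group
      have hc : ⁅w j, ⁅v j, g j⁆⁆ ∈ T (n + 2) :=
        h3 (Subgroup.commutator_mem_commutator (hw j)
          (Subgroup.commutator_mem_commutator (hvH j) (Subgroup.mem_top _)))
      have hc' : mk ⁅w j, ⁅v j, g j⁆⁆ = 1 := by
        rw [QuotientGroup.mk'_apply, QuotientGroup.eq_one_iff]; exact hc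
      rw [h1, map_mul, hc', one_mul, map_mul]
    have hcen : ∀ j, mk ⁅w j, g j⁆ ∈ Subgroup.center (G ⧸ T (n + 2)) := fun j =>
      mk_mem_center_of_commutator_le hTn1_le
        (by rw [hT1]; exact Subgroup.commutator_mem_commutator (hw j) (Subgroup.mem_top _))
    have hprod : mk (List.ofFn fun j => ⁅w j * v j, g j⁆).prod =
        mk (List.ofFn fun j => ⁅v j, g j⁆).prod * mk (List.ofFn fun j => ⁅w j, g j⁆).prod := by
      rw [map_list_prod, map_list_prod, map_list_prod, List.map_ofFn, List.map_ofFn, List.map_ofFn]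
      simp only [Function.comp_def]
      rw [show (fun j => mk ⁅w j * v j, g j⁆) = fun j => mk ⁅v j, g j⁆ * mk ⁅w j, g j⁆ from
        funext hfac]
      exact prod_ofFn_mul_of_mem_center _ _ hcen
    -- `mk z = mk Φ(w)` and `h = Φ(v) * z`
    have hzq : mk z = mk (List.ofFn fun j => ⁅w j, g j⁆).prod := by
      rw [QuotientGroup.mk'_apply, QuotientGroup.mk'_apply, QuotientGroup.eq]; exact hzw
    have hh' : h = (List.ofFn fun j => ⁅v j, g j⁆).prod * z := by rw [hz]; group
    rw [hprod, ← hzq, ← map_mul, ← hh']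

/-- **Stabilisation.** In a finite group the lower `G`-central series of a normal subgroup `H` stabilises:
there is `N` with `H_{N+1} = H_N`; the stable term `K₀ = H_N` satisfies `⁅K₀, G⁆ = K₀`
(the "`G`-hypocentral residual" of `H`; an acceptable subgroup in the sense of Nikolov–Segal when
`G` is soluble). [cite: NikolovSegal2007, §2] -/
theorem exists_iterate_commutator_top_eq_succ [Finite G] (H : Subgroup G) [H.Normal] :
    ∃ N : ℕ, ⁅(fun K : Subgroup G => ⁅K, (⊤ : Subgroup G)⁆)^[N] H, (⊤ : Subgroup G)⁆ =
      (fun K : Subgroup G => ⁅K, (⊤ : Subgroup G)⁆)^[N] H := by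
  set T : ℕ → Subgroup G := fun m => (fun K : Subgroup G => ⁅K, (⊤ : Subgroup G)⁆)^[m] H with hT
  obtain ⟨a, b, hab, heq⟩ := Finite.exists_ne_map_eq_of_infinite T
  -- w.l.o.g. `a < b`
  wlog hlt : a < b generalizing a b
  · exact this b a hab.symm heq.symm (lt_of_le_of_ne (not_lt.mp hlt) hab.symm)
  refine ⟨a, le_antisymm ?_ ?_⟩
  · have := iterate_commutator_top_succ_le H a
    rwa [Function.iterate_succ_apply'] at this
  · -- `T a = T b ≤ T (a+1) = ⁅T a, G⁆`
    have hle : T b ≤ T (a + 1) := iterate_commutator_top_le_of_le H (Nat.succ_le_of_lt hlt)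
    rw [← heq] at hle
    simpa [hT, Function.iterate_succ_apply'] using hle

end Literature.GroupTheory
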